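/-
Copyright (c) 2026 the pub-hodgecm-mathlib formalisation cell (harness21).  Prover seat hodgecm-mathlib-B-p14 (g35): road «S3-tree» (LEAD F0P3a-plan (g11) WORD T10-2; architect A-p16 (g28)
census «S3» v3 = DEAL SHEET, acting architect F0P3-p01 (g16)), brick T1 «the `U(3)_v` tree», file T1d-A = EQUIVARIANCE, TYPES ALONG EDGES, THE APARTMENT at `N = 3`; 2026-09-01.
-/
import Literature.NumberTheory.Automorphic.UnitaryLatticeTreeSelfDualFrames     -- ★ T1c (B-p14 (g35))
import Literature.NumberTheory.Automorphic.UnitaryThreeDoubleCosetsAnisotropic   -- ★ B-p14 (g30): `UnitaryGroup.exists_coe_eq_torusDiag` (the torus `diag(α, 1, (σα)⁻¹) ∈ U(σ, Φ₃)`)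
import HarnessLib

/-!
# The lattice graph of a hermitian space — V: `K₀`-EQUIVARIANCE (root, duals, depth, parent), TYPES ALONG EDGES (`M < M′` ⇒ `M` type-two below the self-dual `M′`), and THE APARTMENT
# of the `U(3)` tree: `L_a = latt diag(ϖ^a,1,ϖ^{−a}) = t_a·L₀` (type 0, depth `|a|`), `L′_a = latt diag(ϖ^a,1,ϖ^{1−a}) = t_a·N₁` (type 2), `N₁ = latt diag(1,1,ϖ)` (Bruhat–Tits 1972 §10; Serre, *Trees* II.1.1)

Topic `NumberTheory/Automorphic`; namespace `Literature.NumberTheory.Automorphic.UnitaryLatticeTree`.  THEOREMS ONLY (no definition, no instance, no notation, no named fact,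
no `sorry`); kernel lane.  Cell `pub/hodgecm-mathlib` (D-0151), crux H413 = `stmt-HodgeConjecture-24833`; road «S3-tree» (census «S3» v3 §1 rulings A-49/A-53), brick **T1** over the
definitions ★ `UnitaryLatticeTreeDefs` (T1a; rank-`N` sibling of ★ `HermitianLatticeTree*`, `Valued K ℤᵐ⁰` currency).  HONEST LABEL: HC_CM is proved only modulo the 2 remaining named inputs (hLiu418 24832, h413 24833) until rung 0 closes; nothing printed is asserted here (elementary lattice
algebra over a valuation ring); S3 stays a print row until the road's END lands.

* §15 `mem_mapGL_iff`, `pairing_mulVec_mulVec_of_mem_unitary`, **`dualLatt_mapGL`** (`(u·M)^♯ = u·M^♯`), **`mapGL_stdLattice_of_mem_unitaryInt`** (`K₀` fixes the root), `mapGL_scaleLattice_stdLattice_…`,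
  **`latticeDepth_mapGL_of_mem_unitaryInt`**, `mapGL_inf`, **`latticeParent_mapGL_of_mem_unitaryInt`**, `isVertexLattice_mapGL_coe_iff`.
* §16 **`isSelfDualLattice_stdLattice`** (the root is a vertex), **`type_unique`**, **`type_of_lt_three`** (`N = 3`: an edge `M < M′` has `M` of type `2`, `M′` self-dual), `scaleLattice_le_of_lt` (`ϖM′ ≤ M`).
* §17 `dualLatt_eq_self_of_isSelfDualLattice`, `diagonal_three_eq`, **`exists_coe_eq_diagonal_zpow`** (`t_a ∈ U`), `mapGL_coe_latt_eq`, `diagonal_three_mul`,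
  **`isVertexLattice_two_latt_diagonal_one_one`** (`N₁` has type `2`, Gram `[[0,0,ϖ],[0,1,0],[ϖ,0,0]]`), **`isSelfDualLattice_latt_diagonal_zpow`** (`L_a`), **`isVertexLattice_two_latt_diagonal_zpow`** (`L′_a`),
  **`latticeDepth_latt_diagonal_zpow_selfDual`** (`= |a|`), **`latticeDepth_latt_diagonal_zpow_two`** (`= max(a, 1−a)`).

## References
* [BruhatTits1972] F. Bruhat, J. Tits, *Groupes réductifs sur un corps local I*, Publ. Math. IHÉS 41 (1972), §10 (the building of a rank-one group is a tree).
* [Tits1979] J. Tits, *Reductive groups over local fields*, PSPM 33.1 (1979), §3.3.3 (hyperspecial `K₀ = 𝒢(𝒪)`), §2.4 (quasi-split unitary groups).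
* [Serre1980Trees] J.-P. Serre, *Trees* (1980), Ch. II §1.1 (the tree of `SL₂`: lattices, adjacency, distance from a base lattice).
* [Jacobowitz1962] R. Jacobowitz, *Hermitian forms over local fields*, Amer. J. Math. 84 (1962), §4, §7–§8 (Gram matrices, unimodular and `𝔭`-modular hermitian lattices).
* [Omeara1963] O. T. O'Meara, *Introduction to Quadratic Forms* (1963), §82F (primitive vectors, unimodular lattices).
-/

set_option autoImplicit false

noncomputable section

open scoped Valued WithZero Matrix MatrixGroups

namespace Literature.NumberTheory.Automorphic.UnitaryLatticeTree

open Literature.NumberTheory.Automorphic Literature.NumberTheory.Automorphic.HermitianLattice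
open Literature.NumberTheory.Automorphic.CartanUnique

variable {K : Type*} [Field K] [Valued K ℤᵐ⁰] {σ : K →+* K} {ϖ : K} {N : ℕ}

/-! ## §15 Equivariance: `K₀` fixes the root, commutes with duals, depth and parent -/

/-- Membership in a translated lattice: `x ∈ g·M ↔ g⁻¹x ∈ M`. [cite: Serre1980Trees, II.1.1] -/
theorem mem_mapGL_iff (g : GL (Fin N) K) (M : Submodule 𝒪[K] (Fin N → K)) (x : Fin N → K) :
    x ∈ mapGL g M ↔ ((g⁻¹ : GL (Fin N) K) : Matrix (Fin N) (Fin N) K).mulVec x ∈ M := by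
  rw [mapGL, Submodule.mem_map]
  constructor
  · rintro ⟨y, hy, rfl⟩
    rwa [LinearMap.restrictScalars_apply, Matrix.toLin'_apply, Matrix.mulVec_mulVec, ← Units.val_mul, inv_mul_cancel, Units.val_one, Matrix.one_mulVec]
  · intro h
    exact ⟨_, h, by rw [LinearMap.restrictScalars_apply, Matrix.toLin'_apply, Matrix.mulVec_mulVec, ← Units.val_mul, mul_inv_cancel, Units.val_one, Matrix.one_mulVec]⟩

omit [Valued K ℤᵐ⁰] in
/-- Unitarity of the pairing: `⟨u y, u z⟩_H = ⟨y, z⟩_H` for `u ∈ U(σ, H)`. [cite: Jacobowitz1962, §4] -/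
theorem pairing_mulVec_mulVec_of_mem_unitary {H : Matrix (Fin N) (Fin N) K} {u : GL (Fin N) K} (hu : u ∈ unitaryGroupOfForm σ H) (y z : Fin N → K) :
    pairing σ H ((u : Matrix (Fin N) (Fin N) K).mulVec y) ((u : Matrix (Fin N) (Fin N) K).mulVec z) = pairing σ H y z := by
  have hu' : formCongr σ u H = H := hu
  rw [pairing_mulVec_mulVec, hu']

/-- **The dual lattice is `U(σ, H)`-equivariant**: `(u·M)^♯ = u·M^♯`. [cite: Jacobowitz1962, §4] [cite: BruhatTits1972, §10] -/
theorem dualLatt_mapGL {H : Matrix (Fin N) (Fin N) K} {u : GL (Fin N) K} (hu : u ∈ unitaryGroupOfForm σ H) (M : Submodule 𝒪[K] (Fin N → K)) :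
    dualLatt σ H (mapGL u M) = mapGL u (dualLatt σ H M) := by
  ext x
  rw [mem_dualLatt, mem_mapGL_iff, mem_dualLatt]
  have hux : (u : Matrix (Fin N) (Fin N) K).mulVec (((u⁻¹ : GL (Fin N) K) : Matrix (Fin N) (Fin N) K).mulVec x) = x := by
    rw [Matrix.mulVec_mulVec, ← Units.val_mul, mul_inv_cancel, Units.val_one, Matrix.one_mulVec]
  constructor
  · intro h y hy
    have := h _ (Submodule.mem_map.2 ⟨y, hy, rfl⟩)
    rw [LinearMap.restrictScalars_apply, Matrix.toLin'_apply] at this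
    rwa [← hux, pairing_mulVec_mulVec_of_mem_unitary hu] at this
  · intro h y hy
    obtain ⟨y', hy', rfl⟩ := Submodule.mem_map.1 hy
    rw [LinearMap.restrictScalars_apply, Matrix.toLin'_apply, ← hux, pairing_mulVec_mulVec_of_mem_unitary hu]
    exact h y' hy'

/-- **`K₀` fixes the root**: `κ·𝒪^N = 𝒪^N` for `κ ∈ K₀ = U ∩ GL_N(𝒪)`. [cite: Tits1979, §3.3.3] -/
theorem mapGL_stdLattice_of_mem_unitaryInt {H : Matrix (Fin N) (Fin N) K} {κ : unitaryGroupOfForm σ H} (hκ : κ ∈ unitaryInt σ H) :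
    mapGL (κ : GL (Fin N) K) (stdLattice K N) = stdLattice K N := by
  obtain ⟨h1, h2⟩ := mem_unitaryInt_iff.1 hκ
  have hrfl : mapGL (κ : GL (Fin N) K) (stdLattice K N) = latt ((κ : GL (Fin N) K) : Matrix (Fin N) (Fin N) K) := rfl
  rw [hrfl]
  refine le_antisymm ((latt_le_stdLattice_iff _).2 h1) ?_
  rw [← latt_one, latt_le_latt_iff (Matrix.isUnits_det_units _), Matrix.mul_one, ← Matrix.coe_units_inv]
  exact h2

/-- `K₀` fixes every scaled root `c·𝒪^N`. [cite: Tits1979, §3.3.3] -/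
theorem mapGL_scaleLattice_stdLattice_of_mem_unitaryInt {H : Matrix (Fin N) (Fin N) K} {κ : unitaryGroupOfForm σ H} (hκ : κ ∈ unitaryInt σ H) (c : K) :
    mapGL (κ : GL (Fin N) K) (scaleLattice c (stdLattice K N)) = scaleLattice c (stdLattice K N) := by
  rw [mapGL_scaleLattice, mapGL_stdLattice_of_mem_unitaryInt hκ]

/-- **The depth is `K₀`-invariant.** [cite: Serre1980Trees, II.1.1] -/
theorem latticeDepth_mapGL_of_mem_unitaryInt {H : Matrix (Fin N) (Fin N) K} {κ : unitaryGroupOfForm σ H} (hκ : κ ∈ unitaryInt σ H) (M : Submodule 𝒪[K] (Fin N → K)) :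
    latticeDepth ϖ (mapGL (κ : GL (Fin N) K) M) = latticeDepth ϖ M := by
  unfold latticeDepth
  congr 1
  ext k
  simp only [Set.mem_setOf_eq]
  conv_lhs => rw [← mapGL_scaleLattice_stdLattice_of_mem_unitaryInt hκ (ϖ ^ k)]
  rw [mapGL_le_mapGL_iff]

/-- `g·(A ⊓ B) = g·A ⊓ g·B`. [cite: Serre1980Trees, II.1.1] -/
theorem mapGL_inf (g : GL (Fin N) K) (A B : Submodule 𝒪[K] (Fin N → K)) : mapGL g (A ⊓ B) = mapGL g A ⊓ mapGL g B :=
  Submodule.map_inf _ (fun x y hxy => by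
    have := congrArg (((g⁻¹ : GL (Fin N) K) : Matrix (Fin N) (Fin N) K).mulVec) hxy
    simpa only [LinearMap.restrictScalars_apply, Matrix.toLin'_apply, Matrix.mulVec_mulVec, ← Units.val_mul, inv_mul_cancel, Units.val_one, Matrix.one_mulVec] using this)

/-- **The parent is `K₀`-equivariant**: `P(κ·M) = κ·P(M)`. [cite: Serre1980Trees, II.1.1] -/
theorem latticeParent_mapGL_of_mem_unitaryInt {H : Matrix (Fin N) (Fin N) K} {κ : unitaryGroupOfForm σ H} (hκ : κ ∈ unitaryInt σ H) (M : Submodule 𝒪[K] (Fin N → K)) :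
    latticeParent σ ϖ H (mapGL (κ : GL (Fin N) K) M) = mapGL (κ : GL (Fin N) K) (latticeParent σ ϖ H M) := by
  rw [latticeParent, latticeParent, latticeDepth_mapGL_of_mem_unitaryInt hκ, dualLatt_mapGL κ.2, mapGL_inf, mapGL_scaleLattice_stdLattice_of_mem_unitaryInt hκ]

/-- Types are `K₀`- (indeed `U`-) invariant — restated for subgroup elements. [cite: BruhatTits1972, §10] -/
theorem isVertexLattice_mapGL_coe_iff {H : Matrix (Fin N) (Fin N) K} (u : unitaryGroupOfForm σ H) {d : ℕ} (M : Submodule 𝒪[K] (Fin N → K)) :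
    IsVertexLattice σ ϖ H d (mapGL (u : GL (Fin N) K) M) ↔ IsVertexLattice σ ϖ H d M := isVertexLattice_mapGL_iff σ ϖ H u M

/-! ## §16 The root and the type of a vertex -/

/-- **The root `𝒪^N` is a self-dual vertex** for a unimodular form (`H`, `H⁻¹` integral, `v(det H) = 1`) and `|ϖ| ≤ 1`. [cite: Jacobowitz1962, §7] -/
theorem isSelfDualLattice_stdLattice {H : Matrix (Fin N) (Fin N) K} (hHi : IsIntMatrix H) (hHi' : IsIntMatrix H⁻¹) (hdet : Valued.v H.det = 1) (hϖ : Valued.v ϖ ≤ 1) :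
    IsSelfDualLattice σ ϖ H (stdLattice K N) := by
  refine ⟨1, by rw [Units.val_one, latt_one], ?_, ?_, ?_⟩
  all_goals simp only [formCongr, Units.val_one, Matrix.map_one σ (map_zero σ) (map_one σ), Matrix.transpose_one, Matrix.one_mul, Matrix.mul_one]
  · exact hHi
  · intro i j; rw [Matrix.smul_apply, smul_eq_mul, map_mul]; exact mul_le_one' hϖ (hHi' i j)
  · rw [hdet, pow_zero]

/-- **The type of a vertex is unique** (`σ` valuation-preserving, `|ϖ| < 1`, `ϖ ≠ 0`). [cite: BruhatTits1972, §10] -/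
theorem type_unique (hvσ : ∀ a, Valued.v (σ a) = Valued.v a) (hϖ : Valued.v ϖ = WithZero.exp (-1 : ℤ)) {H : Matrix (Fin N) (Fin N) K} {d d' : ℕ}
    {M : Submodule 𝒪[K] (Fin N → K)} (hM : IsVertexLattice σ ϖ H d M) (hM' : IsVertexLattice σ ϖ H d' M) : d = d' := by
  obtain ⟨g, hg, -, -, hdet⟩ := hM
  obtain ⟨g', hg', -, -, hdet'⟩ := hM'
  have hg'u : IsUnit (g' : Matrix (Fin N) (Fin N) K).det := Matrix.isUnits_det_units g'
  have hgu : IsUnit (g : Matrix (Fin N) (Fin N) K).det := Matrix.isUnits_det_units g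
  set P : Matrix (Fin N) (Fin N) K := (g' : Matrix (Fin N) (Fin N) K)⁻¹ * (g : Matrix (Fin N) (Fin N) K) with hPdef
  have hPint : IsIntMatrix P := (latt_le_latt_iff hg'u _).1 (hg ▸ hg' ▸ le_rfl)
  have hPinv : IsIntMatrix P⁻¹ := by
    have : P⁻¹ = (g : Matrix (Fin N) (Fin N) K)⁻¹ * (g' : Matrix (Fin N) (Fin N) K) := by rw [hPdef, Matrix.mul_inv_rev, Matrix.nonsing_inv_nonsing_inv _ hg'u]
    rw [this]; exact (latt_le_latt_iff hgu _).1 (hg' ▸ hg ▸ le_rfl)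
  have hvP : Valued.v P.det = 1 := by
    have h1 : Valued.v P.det ≤ 1 := v_det_le_one_of_forall_v_le_one hPint
    have h2 : Valued.v P⁻¹.det ≤ 1 := v_det_le_one_of_forall_v_le_one hPinv
    have hPu : IsUnit P.det := by rw [hPdef, Matrix.det_mul]; exact (Matrix.isUnit_nonsing_inv_det_iff.2 hg'u).mul hgu
    rw [Matrix.det_nonsing_inv, Ring.inverse_eq_inv', map_inv₀] at h2
    have hne : Valued.v P.det ≠ 0 := (Valuation.ne_zero_iff _).2 hPu.ne_zero
    exact le_antisymm h1 (by rwa [inv_le_one₀ (zero_lt_iff.2 hne)] at h2)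
  have hgP : (g : Matrix (Fin N) (Fin N) K) = (g' : Matrix (Fin N) (Fin N) K) * P := by
    rw [hPdef, ← Matrix.mul_assoc, Matrix.mul_nonsing_inv _ hg'u, Matrix.one_mul]
  have hG : formCongr σ g H = (P.map σ)ᵀ * formCongr σ g' H * P := by
    simp only [formCongr, hgP, Matrix.map_mul, Matrix.transpose_mul, Matrix.mul_assoc]
  have hv : Valued.v (formCongr σ g H).det = Valued.v (formCongr σ g' H).det := by
    rw [hG, Matrix.det_mul, Matrix.det_mul, map_mul, map_mul, Matrix.det_transpose, ← RingHom.mapMatrix_apply, ← RingHom.map_det, hvσ, hvP, one_mul, mul_one]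
  rw [hdet, hdet', hϖ, ← WithZero.exp_nsmul, ← WithZero.exp_nsmul, WithZero.exp_inj] at hv
  simp only [nsmul_eq_mul, mul_neg, mul_one, neg_inj, Nat.cast_inj] at hv
  exact hv

/-- **Edges join a self-dual vertex and a type-two vertex BELOW it** (`N = 3`, unimodular `H`, `σ` valuation-preserving, `ϖ` a uniformiser): if `M < M′` are vertices then `M` has type `2`
and `M′` is self-dual. [cite: BruhatTits1972, §10] -/
theorem type_of_lt_three (hvσ : ∀ a, Valued.v (σ a) = Valued.v a) (hϖ : Valued.v ϖ = WithZero.exp (-1 : ℤ)) {H : Matrix (Fin 3) (Fin 3) K} (hH : Valued.v H.det = 1)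
    {d d' : ℕ} {M M' : Submodule 𝒪[K] (Fin 3 → K)} (hM : IsVertexLattice σ ϖ H d M) (hM' : IsVertexLattice σ ϖ H d' M') (hlt : M < M') : d = 2 ∧ d' = 0 := by
  have hϖ0 : ϖ ≠ 0 := fun h => by rw [h, map_zero] at hϖ; exact WithZero.coe_ne_zero hϖ.symm
  rcases type_eq_zero_or_two_of_isVertexLattice_three hvσ hϖ hH hM with rfl | rfl <;>
    rcases type_eq_zero_or_two_of_isVertexLattice_three hvσ hϖ hH hM' with rfl | rfl
  · exact absurd (eq_of_le_of_isVertexLattice hvσ hϖ0 hM hM' hlt.le) hlt.ne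
  · -- self-dual `M` < type-two `M′ ≤ M′^♯ ≤ M^♯ = ?` : impossible since `M′ ≤ M^♯` and `M = M^♯`… via `M′ ≤ M′^♯ ≤ M^♯` and `M^♯ = M`-type inclusion
    exfalso
    obtain ⟨g, rfl, hG, -, hdet⟩ := hM
    have hHu : IsUnit H.det := isUnit_iff_ne_zero.2 fun h0 => by rw [h0, map_zero] at hH; exact zero_ne_one hH
    have hself : dualLatt σ H (latt (g : Matrix (Fin 3) (Fin 3) K)) ≤ latt (g : Matrix (Fin 3) (Fin 3) K) := by
      rw [dualLatt_latt σ hvσ hHu g, latt_mul_le_latt_iff (Matrix.isUnits_det_units g)]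
      rw [pow_zero] at hdet
      exact isIntMatrix_nonsing_inv_of_v_det_eq_one hG hdet
    have h1 : M' ≤ dualLatt σ H M' := le_dualLatt_of_isVertexLattice hvσ hM'
    have h2 : dualLatt σ H M' ≤ dualLatt σ H (latt (g : Matrix (Fin 3) (Fin 3) K)) := dualLatt_antitone σ H hlt.le
    exact hlt.ne (le_antisymm hlt.le (h1.trans (h2.trans hself)))
  · exact ⟨rfl, rfl⟩
  · exact absurd (eq_of_le_of_isVertexLattice hvσ hϖ0 hM hM' hlt.le) hlt.ne

/-- **Depth along an edge**: if `M < M′` (vertices, `M′` self-dual of depth `k`) then `k ≤ depth M ≤ k + 1` — since `ϖ^{k+1}L₀ ≤ ϖM′ ≤ M < M′`. In the form: `ϖ·M′ ≤ M`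
and the two depth inequalities. [cite: Serre1980Trees, II.1.1] -/
theorem scaleLattice_le_of_lt (hvσ : ∀ a, Valued.v (σ a) = Valued.v a) {H : Matrix (Fin N) (Fin N) K} (hH : IsUnit H.det) {d' : ℕ} {M M' : Submodule 𝒪[K] (Fin N → K)}
    (hM : IsVertex σ ϖ H M) (hM' : IsVertexLattice σ ϖ H d' M') (hle : M ≤ M') : scaleLattice ϖ M' ≤ M := by
  obtain ⟨d, hd⟩ := hM
  calc scaleLattice ϖ M' ≤ scaleLattice ϖ (dualLatt σ H M') := Submodule.map_mono (le_dualLatt_of_isVertexLattice hvσ hM')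
    _ ≤ scaleLattice ϖ (dualLatt σ H M) := Submodule.map_mono (dualLatt_antitone σ H hle)
    _ ≤ M := scaleLattice_dualLatt_le_of_isVertexLattice hvσ hH hd

end Literature.NumberTheory.Automorphic.UnitaryLatticeTree

namespace Literature.NumberTheory.Automorphic.UnitaryLatticeTree

open Literature.NumberTheory.Automorphic Literature.NumberTheory.Automorphic.HermitianLattice
open Literature.NumberTheory.Automorphic.CartanUnique

variable {K : Type*} [Field K] [Valued K ℤᵐ⁰] {σ : K →+* K} {ϖ : K} {N : ℕ}

/-! ## §17 A self-dual vertex equals its dual; the apartment at `N = 3`: `L_a = t_a·L₀` (type 0), `L′_a = t_a·N₁` (type 2), their depths -/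

/-- **A self-dual vertex equals its dual**: `M^♯ = M` for type `0` (`H` invertible, `σ` valuation-preserving). [cite: Jacobowitz1962, §7] -/
theorem dualLatt_eq_self_of_isSelfDualLattice (hvσ : ∀ a, Valued.v (σ a) = Valued.v a) {H : Matrix (Fin N) (Fin N) K} (hH : IsUnit H.det)
    {M : Submodule 𝒪[K] (Fin N → K)} (hM : IsSelfDualLattice σ ϖ H M) : dualLatt σ H M = M := by
  refine le_antisymm ?_ (le_dualLatt_of_isVertexLattice hvσ hM)
  obtain ⟨g, rfl, hG, -, hdet⟩ := hM
  rw [pow_zero] at hdet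
  rw [dualLatt_latt σ hvσ hH g, latt_mul_le_latt_iff (Matrix.isUnits_det_units g)]
  exact isIntMatrix_nonsing_inv_of_v_det_eq_one hG hdet

omit [Valued K ℤᵐ⁰] in
/-- `diagonal ![a, b, c]` as an explicit matrix. [cite: Serre1980Trees, II.1.1] -/
theorem diagonal_three_eq (a b c : K) : (Matrix.diagonal ![a, b, c] : Matrix (Fin 3) (Fin 3) K) = !![a, 0, 0; 0, b, 0; 0, 0, c] := by
  ext i j; fin_cases i <;> fin_cases j <;> simp [Matrix.diagonal]

omit [Valued K ℤᵐ⁰] in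
/-- **The torus element `t_a = diag(ϖ^a, 1, ϖ^{−a}) ∈ U(σ, J₀)`** (`σ` an involution fixing `ϖ ≠ 0`), as an element with a prescribed matrix. [cite: BruhatTits1972, §10] [cite: Tits1979, §3.3.3] -/
theorem exists_coe_eq_diagonal_zpow (hσ : ∀ x, σ (σ x) = x) (hσϖ : σ ϖ = ϖ) (hϖ : ϖ ≠ 0) (a : ℤ) :
    ∃ t : unitaryGroupOfForm σ ((StdForm.antidiagonal 3).over K), ((t : GL (Fin 3) K) : Matrix (Fin 3) (Fin 3) K) = Matrix.diagonal ![ϖ ^ a, 1, ϖ ^ (-a)] := by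
  obtain ⟨t, ht⟩ := UnitaryGroup.exists_coe_eq_torusDiag σ rfl hσ (zpow_ne_zero a hϖ)
  refine ⟨t, ?_⟩
  rw [ht, diagonal_three_eq, map_zpow₀, hσϖ, zpow_neg]

/-- `t_a · latt A = latt (t_a A)` on matrices, for a subgroup element with prescribed matrix. [cite: Serre1980Trees, II.1.1] -/
theorem mapGL_coe_latt_eq {H : Matrix (Fin N) (Fin N) K} (t : unitaryGroupOfForm σ H) {T : Matrix (Fin N) (Fin N) K} (ht : ((t : GL (Fin N) K) : Matrix (Fin N) (Fin N) K) = T)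
    (A : Matrix (Fin N) (Fin N) K) : mapGL (t : GL (Fin N) K) (latt A) = latt (T * A) := by
  rw [mapGL, ht, latt_mul]

omit [Valued K ℤᵐ⁰] in
/-- Products of `Fin 3` diagonal matrices. [cite: Serre1980Trees, II.1.1] -/
theorem diagonal_three_mul (a b c a' b' c' : K) :
    (Matrix.diagonal ![a, b, c] : Matrix (Fin 3) (Fin 3) K) * Matrix.diagonal ![a', b', c'] = Matrix.diagonal ![a * a', b * b', c * c'] := by
  rw [Matrix.diagonal_mul_diagonal]
  congr 1
  funext i; fin_cases i <;> rfl

/-- **The standard type-two neighbour `N₁ = latt diag(1, 1, ϖ) = {y ∈ 𝒪³ | y₂ ∈ 𝔪}` is a vertex of type `2`** (`σϖ = ϖ`, `|ϖ| ≤ 1`, `ϖ ≠ 0`; Gram `[[0,0,ϖ],[0,1,0],[ϖ,0,0]]`).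
[cite: BruhatTits1972, §10] [cite: Jacobowitz1962, §8] -/
theorem isVertexLattice_two_latt_diagonal_one_one (hσϖ : σ ϖ = ϖ) (hϖ1 : Valued.v ϖ ≤ 1) (hϖ : ϖ ≠ 0) :
    IsVertexLattice σ ϖ ((StdForm.antidiagonal 3).over K) 2 (latt (Matrix.diagonal ![(1 : K), 1, ϖ])) := by
  have hdet : (Matrix.diagonal ![(1 : K), 1, ϖ]).det ≠ 0 := by
    rw [Matrix.det_diagonal]; simp [Fin.prod_univ_three, hϖ]
  refine ⟨Matrix.GeneralLinearGroup.mkOfDetNeZero _ hdet, by rw [Matrix.GeneralLinearGroup.val_mkOfDetNeZero], ?_⟩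
  have hJ : ∀ i j : Fin 3, (StdForm.antidiagonal 3).over K i j = if j = Fin.rev i then (1 : K) else 0 := by
    intro i j
    simp only [StdForm.over, Matrix.map_apply, StdForm.antidiagonal_J_apply]
    split_ifs <;> simp
  have hG : formCongr σ (Matrix.GeneralLinearGroup.mkOfDetNeZero _ hdet) ((StdForm.antidiagonal 3).over K) = !![0, 0, ϖ; 0, 1, 0; ϖ, 0, 0] := by
    rw [formCongr, Matrix.GeneralLinearGroup.val_mkOfDetNeZero]
    ext i j
    fin_cases i <;> fin_cases j <;> simp [Matrix.mul_apply, Fin.sum_univ_three, Matrix.diagonal, hJ, hσϖ, Fin.rev, Matrix.map_apply]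
  have hGinv : (!![0, 0, ϖ; 0, 1, 0; ϖ, 0, 0] : Matrix (Fin 3) (Fin 3) K)⁻¹ = !![0, 0, ϖ⁻¹; 0, 1, 0; ϖ⁻¹, 0, 0] := by
    apply Matrix.inv_eq_left_inv
    ext i j
    fin_cases i <;> fin_cases j <;> simp [Matrix.mul_apply, Fin.sum_univ_three, hϖ]
  rw [hG, hGinv]
  refine ⟨?_, ?_, ?_⟩
  · intro i j; fin_cases i <;> fin_cases j <;> simp [hϖ1]
  · intro i j; fin_cases i <;> fin_cases j <;> simp [hϖ1, hϖ]
  · rw [Matrix.det_fin_three]; simp [pow_two]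

/-- **The apartment vertices `L_a = latt diag(ϖ^a, 1, ϖ^{−a})` are self-dual** and `L_a = t_a · L₀`. [cite: BruhatTits1972, §10] [cite: Serre1980Trees, II.1.1] -/
theorem isSelfDualLattice_latt_diagonal_zpow (hσ : ∀ x, σ (σ x) = x) (hσϖ : σ ϖ = ϖ) (hϖ1 : Valued.v ϖ ≤ 1) (hϖ : ϖ ≠ 0) (a : ℤ) :
    IsSelfDualLattice σ ϖ ((StdForm.antidiagonal 3).over K) (latt (Matrix.diagonal ![ϖ ^ a, 1, ϖ ^ (-a)])) := by
  obtain ⟨t, ht⟩ := exists_coe_eq_diagonal_zpow hσ hσϖ hϖ a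
  have h1 : latt (Matrix.diagonal ![ϖ ^ a, 1, ϖ ^ (-a)]) = mapGL (t : GL (Fin 3) K) (stdLattice K 3) := by
    rw [← latt_one, mapGL_coe_latt_eq t ht, Matrix.mul_one]
  rw [h1]
  refine isVertexLattice_mapGL σ ϖ _ _ t.2 (isSelfDualLattice_stdLattice ?_ ?_ ?_ hϖ1)
  · intro i j; simp only [StdForm.over, Matrix.map_apply, StdForm.antidiagonal_J_apply]; split_ifs <;> simp
  · rw [StdForm.inv_over]; intro i j; simp only [StdForm.over, Matrix.map_apply, StdForm.antidiagonal_J_apply]; split_ifs <;> simp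
  · have hJ : ∀ i j : Fin 3, (StdForm.antidiagonal 3).over K i j = if j = Fin.rev i then (1 : K) else 0 := by
      intro i j
      simp only [StdForm.over, Matrix.map_apply, StdForm.antidiagonal_J_apply]
      split_ifs <;> simp
    have hdet : ((StdForm.antidiagonal 3).over K).det = -1 := by
      rw [Matrix.det_fin_three]; simp [hJ, Fin.rev]
    rw [hdet, Valuation.map_neg, map_one]

/-- **The apartment vertices `L′_a = latt diag(ϖ^a, 1, ϖ^{1−a}) = t_a · N₁` are of type `2`.** [cite: BruhatTits1972, §10] [cite: Serre1980Trees, II.1.1] -/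
theorem isVertexLattice_two_latt_diagonal_zpow (hσ : ∀ x, σ (σ x) = x) (hσϖ : σ ϖ = ϖ) (hϖ1 : Valued.v ϖ ≤ 1) (hϖ : ϖ ≠ 0) (a : ℤ) :
    IsVertexLattice σ ϖ ((StdForm.antidiagonal 3).over K) 2 (latt (Matrix.diagonal ![ϖ ^ a, 1, ϖ ^ (1 - a)])) := by
  obtain ⟨t, ht⟩ := exists_coe_eq_diagonal_zpow hσ hσϖ hϖ a
  have h1 : latt (Matrix.diagonal ![ϖ ^ a, 1, ϖ ^ (1 - a)]) = mapGL (t : GL (Fin 3) K) (latt (Matrix.diagonal ![(1 : K), 1, ϖ])) := by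
    rw [mapGL_coe_latt_eq t ht, diagonal_three_mul, mul_one, mul_one, sub_eq_neg_add, zpow_add₀ hϖ, zpow_one, mul_comm]
  rw [h1]
  exact isVertexLattice_mapGL σ ϖ _ _ t.2 (isVertexLattice_two_latt_diagonal_one_one hσϖ hϖ1 hϖ)

/-- **Depth of the apartment vertices**: `depth L_a = |a|`. [cite: Serre1980Trees, II.1.1] -/
theorem latticeDepth_latt_diagonal_zpow_selfDual (hϖ : Valued.v ϖ = WithZero.exp (-1 : ℤ)) (a : ℤ) :
    latticeDepth ϖ (latt (Matrix.diagonal ![ϖ ^ a, (1 : K), ϖ ^ (-a)])) = a.natAbs := by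
  refine latticeDepth_latt_diagonal hϖ (a := ![a, 0, -a]) (fun i => ?_) a.natAbs (fun i => ?_) (fun k' hk' => ?_)
  · fin_cases i
    · simp only [Fin.zero_eta, Matrix.cons_val_zero]; rw [map_zpow₀, hϖ, ← WithZero.exp_zsmul, smul_eq_mul, mul_neg, mul_one]
    · simp only [Fin.mk_one, Matrix.cons_val_one, Matrix.cons_val_zero]; rw [map_one, neg_zero, WithZero.exp_zero]
    · simp only [Fin.reduceFinMk, Matrix.cons_val_two, Matrix.tail_cons, Matrix.head_cons, Nat.succ_eq_add_one]
      rw [map_zpow₀, hϖ, ← WithZero.exp_zsmul, smul_eq_mul, mul_neg, mul_one, neg_neg]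
  · fin_cases i <;>
      simp only [Fin.zero_eta, Fin.mk_one, Fin.reduceFinMk, Matrix.cons_val_zero, Matrix.cons_val_one, Matrix.cons_val_two, Matrix.tail_cons, Matrix.head_cons,
        Nat.succ_eq_add_one] <;> omega
  · have h0 := hk' 0; have h2 := hk' 2
    simp only [Matrix.cons_val_zero, Matrix.cons_val_two, Matrix.tail_cons, Matrix.head_cons, Nat.succ_eq_add_one] at h0 h2
    omega

/-- **Depth of the apartment vertices**: `depth L′_a = max(a, 1 − a)` (as the least `k : ℕ` with `a ≤ k` and `1 − a ≤ k`). [cite: Serre1980Trees, II.1.1] -/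
theorem latticeDepth_latt_diagonal_zpow_two (hϖ : Valued.v ϖ = WithZero.exp (-1 : ℤ)) (a : ℤ) :
    latticeDepth ϖ (latt (Matrix.diagonal ![ϖ ^ a, (1 : K), ϖ ^ (1 - a)])) = (max a (1 - a)).toNat := by
  refine latticeDepth_latt_diagonal hϖ (a := ![a, 0, 1 - a]) (fun i => ?_) _ (fun i => ?_) (fun k' hk' => ?_)
  · fin_cases i
    · simp only [Fin.zero_eta, Matrix.cons_val_zero]; rw [map_zpow₀, hϖ, ← WithZero.exp_zsmul, smul_eq_mul, mul_neg, mul_one]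
    · simp only [Fin.mk_one, Matrix.cons_val_one, Matrix.cons_val_zero]; rw [map_one, neg_zero, WithZero.exp_zero]
    · simp only [Fin.reduceFinMk, Matrix.cons_val_two, Matrix.tail_cons, Matrix.head_cons, Nat.succ_eq_add_one]
      rw [map_zpow₀, hϖ, ← WithZero.exp_zsmul, smul_eq_mul, mul_neg, mul_one]
  · fin_cases i <;>
      simp only [Fin.zero_eta, Fin.mk_one, Fin.reduceFinMk, Matrix.cons_val_zero, Matrix.cons_val_one, Matrix.cons_val_two, Matrix.tail_cons, Matrix.head_cons,
        Nat.succ_eq_add_one] <;> omega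
  · have h0 := hk' 0; have h2 := hk' 2
    simp only [Matrix.cons_val_zero, Matrix.cons_val_two, Matrix.tail_cons, Matrix.head_cons, Nat.succ_eq_add_one] at h0 h2
    omega

end Literature.NumberTheory.Automorphic.UnitaryLatticeTree

end
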